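import Literature.Computability.AlgebraicComplexity.EGOW2018SetSymmetric
import HarnessLib

/-!
# EGOW 2018 §5 — the rank-method barrier constant through matrices with entries from `𝓛_S`
(cell val-lit, typer t22, DAG row EGOW2018-B; source `paper:arxiv-1710.09502`;
bib `EfremenkoGargOliveiraWigderson2018`)

K. Efremenko, A. Garg, R. Oliveira, A. Wigderson, *Barriers for rank methods in arithmetic
complexity*, ITCS 2018 = arXiv:1710.09502, §5 (pp. 15–16). HONEST FRAMING: known linear algebra,
typed and proved; `VP ≠ VNP` is NOT proved and nothing here is progress on it.

The paper's §5 restates rank methods through symbolic matrices ("there exists a rank method which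
proves a lower bound of `R` … if and only if there exists a matrix `L` with entries from `𝓛` such that
`rk_{F(y)}(L) ≤ r` and `rk(𝒞(L)) ≥ rR`", p. 15; tree `EGOW2018_sec5_restatement_entries`) and, for
depth-3 formulas, identifies the entry space with `SSM(y)` (p. 15; tree
`EGOW2018_sec5_entrySpace_eq_ssmSpace`), concluding: "the main challenges are to try to understand
the ranks of matrices with such special entries … Our hope that such a study will lead to either new
lower bounds, or to a new barrier result for this model" (p. 16, p0016.txt:L9–16). This file states
that dichotomy in the tree's BARRIER vocabulary (`RankMethodCeiling`, `RankMethodBarriers.lean`):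

* `forall_rank_le_mul_iff` — for one rank method `L`: "`μ_L ≤ c · μ_L(S)` on `Ŝ`" iff
  `rk(𝒞(L(ψ))) ≤ c · rk_{F(y)}(L(ψ))`.
* `rankMethodCeiling_span_paramImage_iff` — **`c(Δ₀^S) ≤ c` iff every matrix `M` over `F[y]` with
  entries from `𝓛_S` has `rk(𝒞(M)) ≤ c · rk_{F(y)}(M)`** (any parametrised simple set, infinite `F`).
* `rankMethodCeiling_depthThree_iff_ssm` — for the depth-3 instantiation: **rank methods are capped
  at `c` on `Ŝ_D` iff every square matrix whose entries are set-symmetric multilinear polynomials of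
  degree `d` in `y = (y_{ij})_{i ≤ D, j ≤ n}` has `rk(𝒞(M)) ≤ c · rk_{F(y)}(M)`**; equivalently
  (`exists_rankMethod_iff_exists_ssm_matrix`) a rank method proving a bound `R` on `Ŝ_D` exists iff an
  `SSM(y)`-matrix with `rk(𝒞(M)) ≥ R · rk_{F(y)}(M)` exists — "a barrier or a lower bound", p. 16.

All PROVED from the two identities `μ_L(S) = rk_{F(y)}(L(ψ))` and `𝒞(L(ψ)) = L(Ŝ)` of
`EGOW2018Restatement.lean`; no named fact.

## References

* [EfremenkoGargOliveiraWigderson2018] K. Efremenko, A. Garg, R. Oliveira, A. Wigderson,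
  *Barriers for rank methods in arithmetic complexity*, ITCS 2018, LIPIcs 94, 1:1–1:19;
  arXiv:1710.09502, §5 (pp. 15–16), §1.1 (p. 4).
-/

noncomputable section

open MvPolynomial

namespace Literature.Computability.AlgebraicComplexity

section General

variable {F : Type*} [Field F] [Infinite F] {σ τ ι : Type*} [Fintype ι]

/-- **One rank method, restated:** `μ_L(f) ≤ c · μ_L(S)` for all `f ∈ Ŝ` iff the symbolic matrix satisfies
`rk(𝒞(L(ψ))) ≤ c · rk_{F(y)}(L(ψ))` (infinite `F`). [cite: EfremenkoGargOliveiraWigderson2018, §5 Restatement, p. 15] locator: paper:arxiv-1710.09502 p0015.txt:L22 -/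
theorem forall_rank_le_mul_iff (Ψ : MvPolynomial σ (MvPolynomial τ F))
    (L : MvPolynomial σ F →ₗ[F] Matrix ι ι F) (c : ℕ) :
    (∀ f ∈ Submodule.span F (paramImage Ψ), (L f).rank ≤ c * matrixSetRank (L '' paramImage Ψ)) ↔
      matrixSetRank (coeffSpace (symbolicImage L Ψ) : Set (Matrix ι ι F)) ≤
        c * symbolicRank (symbolicImage L Ψ) := by
  rw [matrixSetRank_coeffSpace_symbolicImage, ← matrixSetRank_image_paramImage, matrixSetRank_le_iff,
    Set.forall_mem_image]
  exact Iff.rfl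

/-- **EGOW 2018 §5, the barrier constant through `𝓛_S`:** rank methods for the simple set
`S = ψ(F^t)` are capped at `c` on `Ŝ` (tree `RankMethodCeiling`, "`c(Δ₀^S) ≤ c`", §1.1) iff EVERY square
matrix `M` over `F[y]` with all entries from `𝓛_S` satisfies `rk(𝒞(M)) ≤ c · rk_{F(y)}(M)` (infinite `F`)
— the negation of the printed existence statement for `R = c + 1`.
[cite: EfremenkoGargOliveiraWigderson2018, §5 Restatement, p. 15] locator: paper:arxiv-1710.09502 p0015.txt:L22 -/
theorem rankMethodCeiling_span_paramImage_iff (Ψ : MvPolynomial σ (MvPolynomial τ F)) (c : ℕ) :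
    RankMethodCeiling F (paramImage Ψ)
        (Submodule.span F (paramImage Ψ) : Set (MvPolynomial σ F)) c ↔
      ∀ (m : ℕ) (M : Matrix (Fin m) (Fin m) (MvPolynomial τ F)), (∀ i j, M i j ∈ entrySpace Ψ) →
        matrixSetRank (coeffSpace M : Set (Matrix (Fin m) (Fin m) F)) ≤ c * symbolicRank M := by
  constructor
  · intro h m M hM
    choose ℓ hℓ using fun i j => mem_entrySpace_iff.1 (hM i j)
    have hLM : symbolicImage (matrixOfFunctionals ℓ) Ψ = M := by
      rw [symbolicImage_matrixOfFunctionals]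
      exact Matrix.ext fun i j => hℓ i j
    subst hLM
    rw [← forall_rank_le_mul_iff]
    intro f hf
    exact h.apply (matrixOfFunctionals ℓ)
      (fun g hg => rank_le_matrixSetRank (Set.mem_image_of_mem _ hg)) hf
  · intro h m _ L r hr f hf
    have h1 := (forall_rank_le_mul_iff Ψ L c).2
      (h m (symbolicImage L Ψ) (symbolicImage_mem_entrySpace L Ψ)) f hf
    exact h1.trans (Nat.mul_le_mul_left _
      (matrixSetRank_le (by rintro _ ⟨g, hg, rfl⟩; exact hr g hg)))

end General

/-! ## The depth-3 dichotomy: "a barrier or a lower bound" through `SSM(y)`-matrices -/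

section DepthThree

variable {F : Type*} [Field F] [Infinite F] {n : ℕ}

/-- **EGOW 2018 §5, depth-3 formulas (pp. 15–16): the barrier form.** Rank methods with simple set
`S_D = {Sym_d(ℓ_1, …, ℓ_D)}` are capped at `c` on `Ŝ_D` iff every square matrix `M` over `F[y]`,
`y = (y_{ij})_{i ≤ D, j ≤ n}`, whose entries are set-symmetric multilinear polynomials of degree `d`
(`SSM(y)`, tree `ssmSpace`) satisfies `rk(𝒞(M)) ≤ c · rk_{F(y)}(M)` — "to understand the ranks of
matrices with such special entries … either new lower bounds, or a new barrier result for this model"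
(p. 16). Infinite `F`. [cite: EfremenkoGargOliveiraWigderson2018, §5, pp. 15–16] locator: paper:arxiv-1710.09502 p0016.txt:L9 -/
theorem rankMethodCeiling_depthThree_iff_ssm (d D c : ℕ) :
    RankMethodCeiling F (depthThreeSimple F n d D)
        (Submodule.span F (depthThreeSimple F n d D) : Set (MvPolynomial (Fin n) F)) c ↔
      ∀ (m : ℕ) (M : Matrix (Fin m) (Fin m) (MvPolynomial (Fin D × Fin n) F)),
        (∀ i j, M i j ∈ ssmSpace F n d D) →
          matrixSetRank (coeffSpace M : Set (Matrix (Fin m) (Fin m) F)) ≤ c * symbolicRank M := by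
  rw [depthThreeSimple_eq_paramImage, rankMethodCeiling_span_paramImage_iff,
    EGOW2018_sec5_entrySpace_eq_ssmSpace]

/-- **EGOW 2018 §5, depth-3 formulas: the lower-bound form.** A rank method `L : F[x] → Mat_m(F)` proving
a lower bound of `R` for `Ŝ_D` (some `f ∈ Ŝ_D` with `μ_L(f) ≥ R · μ_L(S_D)`) exists iff there is a square
matrix with entries in `SSM(y)` and `rk(𝒞(M)) ≥ r · R` for some `r ≥ rk_{F(y)}(M)` — the printed
restatement with `𝓛 = SSM(y)` substituted (infinite `F`). [cite: EfremenkoGargOliveiraWigderson2018, §5, pp. 15–16] locator: paper:arxiv-1710.09502 p0016.txt:L5 -/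
theorem exists_rankMethod_iff_exists_ssm_matrix (d D R : ℕ) :
    (∃ (m : ℕ) (L : MvPolynomial (Fin n) F →ₗ[F] Matrix (Fin m) (Fin m) F),
        ∃ f ∈ Submodule.span F (depthThreeSimple F n d D),
          R * matrixSetRank (L '' depthThreeSimple F n d D) ≤ rankMeasure L f) ↔
      ∃ (m : ℕ) (M : Matrix (Fin m) (Fin m) (MvPolynomial (Fin D × Fin n) F)),
        (∀ i j, M i j ∈ ssmSpace F n d D) ∧
          ∃ r : ℕ, symbolicRank M ≤ r ∧
            r * R ≤ matrixSetRank (coeffSpace M : Set (Matrix (Fin m) (Fin m) F)) := by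
  rw [depthThreeSimple_eq_paramImage, EGOW2018_sec5_restatement_entries,
    EGOW2018_sec5_entrySpace_eq_ssmSpace]

end DepthThree

end Literature.Computability.AlgebraicComplexity
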